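import Literature.AlgebraicGeometry.ShimuraVarieties.DiscQuotientSiegelBorelPiece
import Literature.AlgebraicGeometry.ShimuraVarieties.UnitaryShimuraCurveEmbeddingComplex
import Literature.AlgebraicGeometry.HodgeTheory.HodgeGenericQbarDescentProofs
import HarnessLib

/-!
# The slice morphism `Sh_K(U(J⋆), 𝔻)_ℂ ⟶ 𝓜 ⊗_ℚ ℂ` of a holomorphic Siegel period map is algebraic (Borel, compact case)

Topic `AlgebraicGeometry/ShimuraVarieties`; namespace `Literature.AlgebraicGeometry.ShimuraVarieties.UnitaryCanonicalModel`
(dotted on ★ `RecordSystemGS`).  THEOREMS ONLY (no definition, no named fact, no instance, no `sorry`).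

## The mathematics

Let `S` be a record system of the compact unitary Shimura curve `Sh(U(J⋆), 𝔻)` over the CM field `L` read through
`τ : L → ℂ` (★ `UnitaryShimuraCurveRecord.RecordSystemGS`: models `M_K`, complex points `pts : M_K(ℂ) ≃ Sh_K(ℂ)`, and
`pieces` — the complex fibre `(M_K)_τ` is a coproduct of compact DISC quotients `X_q`, each uniformised by
`v ↦ [v, g_q K]` as a ★ `UnitaryBallUniformisationDatum 1`), `K` a small level, and let the TARGET be a smooth
quasi-projective `ℚ`-scheme `M` (e.g. the Siegel fine moduli scheme `𝓐_{g,δ,N}`) with a uniformised chart system on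
`M ⊗_ℚ ℂ` BY VALUE: pieces `ιc_c : Sc_c ⟶ M ⊗_ℚ ℂ` and uniformisations `unif_c : 𝔥_g → Sc_c(ℂ)` continuous on `𝔥_g` and
holomorphic in every affine algebraic coordinate (the (U1)/(U2+) witnesses of ★ `siegelModuli_complexUniformisation_holds`).
Let `f : Sh_K(ℂ) → M(ℂ)` be a point map WITH HOLOMORPHIC SIEGEL LIFTS: for every adelic `a` a piece index `piece a` and a
period function `Z_a`, entrywise holomorphic on the negative cone of `J⋆^τ` and `𝔥_g`-valued there, with
`f [v, aK] = ιc_{piece a} (unif_{piece a} (Z_a v))` ([Deligne1979ShimuraVarieties] 2.3.10: the period point of the PEL datum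
attached to `[v, aK]` depends holomorphically on `v`).

THEN `f` is the map on complex points of a morphism of `ℂ`-schemes `ψ : (M_K)_τ ⟶ M ⊗_ℚ ℂ`
(`RecordSystemGS.exists_hom_of_holomorphicSiegelLifts`; points read through `pts`, `AlgPoints.baseChangeEquiv τ` and the
projection `baseChangeHomFst (algebraMap ℚ ℂ) M`).  Proof: on each piece `X_q` the composite
`X_q(ℂ) → (M_K)_τ(ℂ) ≃ M_K(ℂ) ≃ Sh_K(ℂ) → M(ℂ) ≃ (M ⊗ ℂ)(ℂ)` has the holomorphic Siegel lift `Z_{g_q}` on the disc (the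
`pieces` point clause + `f_mk`), so it is algebraic by Borel's extension theorem in the compact case, from GAGA (★
`DiscQuotientSiegelBorelPiece.exists_hom_of_holomorphicSiegelLift_chart'`); the piece morphisms glue along the coproduct
(`Cofan.IsColimit.desc`), and every point `[v, uK]` is moved to the piece of its class (★ `ShimuraSetGS.mk_eq_mk_mulVec_rep`,
★ `exists_rational_smul_rep_mem`) to read the point formula.  This is the complex half of the PEL slice morphism
`Sh_K(U(J⋆), 𝔻) → 𝓐_{g,δ,N}` ([Deligne1971TravauxShimura] 4.11–4.12, [Milne2005ShimuraVarieties] Thm. 5.16 with Thm. 3.14).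

## References
* [Borel1972ExtensionTheorem] A. Borel, J. Differential Geom. 6 (1972), Thm. 3.10 p. 559.
* [Milne2005ShimuraVarieties] J. S. Milne, *Introduction to Shimura varieties*, Thm. 3.14, Lemma 5.13 p. 57, Thm. 5.16.
* [Deligne1971TravauxShimura] P. Deligne, *Travaux de Shimura*, Sém. Bourbaki 389 (1971), 4.11–4.12 p. 148.
* [Deligne1979ShimuraVarieties] P. Deligne, *Variétés de Shimura*, Proc. Symp. Pure Math. 33 (1979), 2.1.2, 2.3.10.
* [Arapura2012] D. Arapura, *Algebraic Geometry over the Complex Numbers* (2012), §15.4 Cor. 15.4.6.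
-/

set_option autoImplicit false

noncomputable section

open Function MulAction Topology NumberField IsDedekindDomain CategoryTheory CategoryTheory.Limits Matrix AlgebraicGeometry
open scoped Matrix ComplexOrder
open Literature.AlgebraicGeometry.Motives
open Literature.NumberTheory.Automorphic Literature.NumberTheory.Automorphic.UnitaryGroup
open Literature.NumberTheory.Automorphic.Liu2021.AppendixC (C5.OpenCompactSubgroup C5.SmallLevel)
open Literature.NumberTheory.Automorphic.ShimuraDissection
open Literature.AlgebraicGeometry.HodgeTheory (IsQuasiProjectiveOver)

namespace Literature.AlgebraicGeometry.ShimuraVarieties.UnitaryCanonicalModel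

variable {L : Type} [Field L] [NumberField L] [IsCMField L] {Jstar : Matrix (Fin 2) (Fin 2) L} {τ : L →+* ℂ}
  {K₀ : C5.OpenCompactSubgroup ↥(finAdelic (↥(maximalRealSubfield L)) L (IsCMField.complexConj L) 2 Jstar)}

/-! ### §1. One piece: a disc quotient mapped into the chart system with a holomorphic Siegel lift -/

section Piece

variable {g : ℕ} {κ : Type*} (V : SchemeOver ℂ) [Smooth V.hom] (hV : IsQuasiProjectiveOver V)
  (Sc : κ → SchemeOver ℂ) (ιc : ∀ c, Sc c ⟶ V) (unif : ∀ c : κ, Matrix (Fin g) (Fin g) ℂ → ComplexPoints (Sc c))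
  (unif_cont : ∀ c, ContinuousOn (unif c) (siegelUpperHalfSpace g))
  (unif_hol : ∀ (c : κ) (U : (Sc c).left.affineOpens) (s : (Sc c).left.presheaf.obj (Opposite.op (↑U : (Sc c).left.Opens))),
    DifferentiableOn ℂ (fun Z ↦ AlgPoints.evalOrZero (↑U : (Sc c).left.Opens) s (unif c Z))
      (siegelUpperHalfSpace g ∩ unif c ⁻¹' {P | P.pt ∈ (↑U : (Sc c).left.Opens)}))

omit [NumberField L] [IsCMField L] in
include hV unif_cont unif_hol in
/-- **One piece.**  A compact disc quotient `(X, B)` with `B.Hℂ = J⋆^τ`, a map `Φ : Y(ℂ) → V(ℂ)` out of the complex curve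
`Y ⊇ ι(X)` and a point `g` such that `Φ (ι (unif_B v)) = ιc_c (unif_c (Z v))` on the negative cone with `Z` entrywise holomorphic
and `𝔥_g`-valued: then `Φ ∘ ι(ℂ)` is induced by a morphism `X ⟶ V` (★ `exists_hom_of_holomorphicSiegelLift_chart'`, cone
rewritten along `B.Hℂ = J⋆^τ`). [cite: Borel1972ExtensionTheorem, Thm. 3.10 p. 559] [cite: Arapura2012, §15.4 Cor. 15.4.6] -/
theorem exists_hom_piece_of_holomorphicSiegelLift {X Y : SchemeOver ℂ} (B : UnitaryBallUniformisationDatum 1 X)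
    (hB : B.Hℂ = Jstar.map τ) (ι : X ⟶ Y) (Φ : ComplexPoints Y → ComplexPoints V) (c : κ)
    (Z : (Fin 2 → ℂ) → Matrix (Fin g) (Fin g) ℂ)
    (Z_hol : ∀ i j, DifferentiableOn ℂ (fun v => Z v i j) (negCone (Jstar.map τ)))
    (Z_mem : ∀ v, v ∈ negCone (Jstar.map τ) → Z v ∈ siegelUpperHalfSpace g)
    (hΦ : ∀ (v : Fin 2 → ℂ), v ∈ negCone (Jstar.map τ) →
      Φ (AlgPoints.map ι (B.unif v)) = AlgPoints.map (ιc c) (unif c (Z v))) :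
    ∃ ψ : X ⟶ V, ∀ P : ComplexPoints X, AlgPoints.map ψ P = Φ (AlgPoints.map ι P) := by
  have hcone : B.cone = negCone (Jstar.map τ) := by
    change negCone B.Hℂ = negCone (Jstar.map τ)
    rw [hB]
  refine B.exists_hom_of_holomorphicSiegelLift_chart' V hV (ιc c) (unif c) (unif_cont c) (unif_hol c)
    (Φ ∘ AlgPoints.map ι) Z ?_ ?_ ?_
  · intro i j
    rw [hcone]
    exact Z_hol i j
  · intro v hv
    rw [hcone] at hv
    exact Z_mem v hv
  · intro v hv
    rw [hcone] at hv
    exact hΦ v hv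

end Piece

/-! ### §2. The slice morphism of the record curve -/

section Slice

variable (S : RecordSystemGS L Jstar τ K₀) (K : C5.SmallLevel K₀)
  {g : ℕ} {κ : Type*} (M : SchemeOver ℚ) [Smooth M.hom] (hM : IsQuasiProjectiveOver M)
  (Sc : κ → SchemeOver ℂ) (ιc : ∀ c, Sc c ⟶ (Motives.baseChange ℚ ℂ).obj M)
  (unif : ∀ c : κ, Matrix (Fin g) (Fin g) ℂ → ComplexPoints (Sc c))
  (unif_cont : ∀ c, ContinuousOn (unif c) (siegelUpperHalfSpace g))
  (unif_hol : ∀ (c : κ) (U : (Sc c).left.affineOpens) (s : (Sc c).left.presheaf.obj (Opposite.op (↑U : (Sc c).left.Opens))),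
    DifferentiableOn ℂ (fun Z ↦ AlgPoints.evalOrZero (↑U : (Sc c).left.Opens) s (unif c Z))
      (siegelUpperHalfSpace g ∩ unif c ⁻¹' {P | P.pt ∈ (↑U : (Sc c).left.Opens)}))
  (f : ShimuraSetGS L Jstar τ K.1.1 → ComplexPoints M)
  (piece : ↥(finAdelic (↥(maximalRealSubfield L)) L (IsCMField.complexConj L) 2 Jstar) → κ)
  (Z : ↥(finAdelic (↥(maximalRealSubfield L)) L (IsCMField.complexConj L) 2 Jstar) → (Fin 2 → ℂ) → Matrix (Fin g) (Fin g) ℂ)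
  (Z_hol : ∀ (a : ↥(finAdelic (↥(maximalRealSubfield L)) L (IsCMField.complexConj L) 2 Jstar)) (i j : Fin g),
    DifferentiableOn ℂ (fun v => Z a v i j) (negCone (Jstar.map τ)))
  (Z_mem : ∀ (a : ↥(finAdelic (↥(maximalRealSubfield L)) L (IsCMField.complexConj L) 2 Jstar)) (v : Fin 2 → ℂ),
    v ∈ negCone (Jstar.map τ) → Z a v ∈ siegelUpperHalfSpace g)
  (f_mk : ∀ (v : Fin 2 → ℂ) (hv : v ∈ negCone (Jstar.map τ))
      (a : ↥(finAdelic (↥(maximalRealSubfield L)) L (IsCMField.complexConj L) 2 Jstar)),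
    f (ShimuraSetGS.mk L Jstar τ K.1.1 v hv a) =
      (AlgPoints.baseChangeEquiv (algebraMap ℚ ℂ) M).symm (AlgPoints.map (ιc (piece a)) (unif (piece a) (Z a v))))

set_option maxHeartbeats 400000 in -- custody N4 (buildfix lane 2026-09-01 22:39Z): 160k–200k heartbeat cliff; one budget hunk, statement and proof unchanged
include hM unif_cont unif_hol Z_hol Z_mem f_mk in
/-- **The slice morphism of the record curve into a uniformised chart system is algebraic** (Borel, compact case, piece by
piece from GAGA).  For a record system `S` of `Sh(U(J⋆), 𝔻)` read through `τ`, a small level `K`, a smooth quasi-projective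
`ℚ`-scheme `M` with a chart system `(Sc_c, ιc_c, unif_c)` on `M ⊗_ℚ ℂ` (`unif_c` continuous on `𝔥_g` and holomorphic in affine
algebraic coordinates), and a point map `f : Sh_K(ℂ) → M(ℂ)` with holomorphic Siegel lifts `f [v, aK] = ιc (unif (Z_a v))`:
there is `ψ : (M_K)_τ ⟶ M ⊗_ℚ ℂ` over `ℂ` whose value at the complex point `P` of `M_K` (moved to `(M_K)_τ` by
`AlgPoints.baseChangeEquiv τ`), projected to `M`, is `f (pts P)`.  (Pieces ★ `RecordSystemGS.pieces`; per piece
`exists_hom_piece_of_holomorphicSiegelLift`; glue `Cofan.IsColimit.desc`; point bookkeeping ★ `ShimuraSetGS.mk_eq_mk_mulVec_rep`.)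
[cite: Borel1972ExtensionTheorem, Thm. 3.10 p. 559] [cite: Milne2005ShimuraVarieties, Thm. 3.14, Lemma 5.13 p. 57 and Thm. 5.16]
[cite: Deligne1971TravauxShimura, 4.11–4.12 p. 148] [cite: Deligne1979ShimuraVarieties, 2.1.2 and 2.3.10] -/
theorem RecordSystemGS.exists_hom_of_holomorphicSiegelLifts :
    letI : Algebra L ℂ := τ.toAlgebra
    ∃ ψ : (Motives.baseChangeHom τ).obj (S.M.obj K) ⟶ (Motives.baseChange ℚ ℂ).obj M,
      ∀ P : ComplexPoints (S.M.obj K),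
        (AlgPoints.map ψ (AlgPoints.baseChangeEquiv τ (S.M.obj K) P)).left ≫
            Motives.baseChangeHomFst (algebraMap ℚ ℂ) M =
          (f (S.pts K P)).left := by
  letI : Algebra L ℂ := τ.toAlgebra
  classical
  -- §0 the target over `ℂ`: smooth (base change) and quasi-projective (★ `IsQuasiProjectiveOver.baseChangeHom`)
  haveI : Smooth ((Motives.baseChange ℚ ℂ).obj M).hom :=
    MorphismProperty.pullback_snd (P := @Smooth) _ _ ‹Smooth M.hom›
  have hVq : IsQuasiProjectiveOver ((Motives.baseChange ℚ ℂ).obj M) :=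
    Literature.AlgebraicGeometry.HodgeTheory.IsQuasiProjectiveOver.baseChangeHom (algebraMap ℚ ℂ) hM
  -- the point map read on the complex fibre `(M_K)_τ(ℂ) ≃ M_K(ℂ) ≃ Sh_K(ℂ) → M(ℂ) ≃ (M ⊗ ℂ)(ℂ)`
  obtain ⟨Φ, hΦ⟩ : ∃ Φ : ComplexPoints ((Motives.baseChangeHom τ).obj (S.M.obj K)) →
      ComplexPoints ((Motives.baseChange ℚ ℂ).obj M),
      Φ = fun Q => AlgPoints.baseChangeEquiv (algebraMap ℚ ℂ) M
        (f (S.pts K ((AlgPoints.baseChangeEquiv τ (S.M.obj K)).symm Q))) := ⟨_, rfl⟩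
  have hΦpt : ∀ P : ComplexPoints (S.M.obj K),
      Φ (AlgPoints.baseChangeEquiv τ (S.M.obj K) P) = AlgPoints.baseChangeEquiv (algebraMap ℚ ℂ) M (f (S.pts K P)) := by
    intro P
    rw [hΦ]
    dsimp only
    rw [Equiv.symm_apply_apply]
  -- §1 the pieces of `(M_K)_τ` and the piece morphisms
  obtain ⟨gq, hgq, X, ι, hcol, B, hB⟩ := S.pieces K
  have hpiece : ∀ q, ∃ ψq : X q ⟶ (Motives.baseChange ℚ ℂ).obj M,
      ∀ P : ComplexPoints (X q), AlgPoints.map ψq P = Φ (AlgPoints.map (ι q) P) := by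
    intro q
    refine exists_hom_piece_of_holomorphicSiegelLift ((Motives.baseChange ℚ ℂ).obj M) hVq Sc ιc unif unif_cont unif_hol
      (B q) (hB q).1 (ι q) Φ (piece (gq q)) (Z (gq q)) (Z_hol (gq q)) (Z_mem (gq q)) fun v hv => ?_
    rw [(hB q).2.2 v hv, hΦpt, Homeomorph.apply_symm_apply, f_mk v hv (gq q), Equiv.apply_symm_apply]
    rfl
  choose ψq hψq using hpiece
  -- §2 glue along the coproduct and read the point formula on the piece of the class of the point
  refine ⟨Cofan.IsColimit.desc hcol ψq, fun P => ?_⟩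
  obtain ⟨v, hv, u, hP⟩ := ShimuraSetGS.mk_surjective L Jstar τ K.1.1 (S.pts K P)
  obtain ⟨q, δ, hδ⟩ : ∃ q δ, (rationalToFinAdelic (↥(maximalRealSubfield L)) L (IsCMField.complexConj L) 2 Jstar δ * u)⁻¹ *
      gq q ∈ K.1.1 :=
    ⟨_, exists_rational_smul_rep_mem (F := ↥(maximalRealSubfield L)) (c := IsCMField.complexConj L) hgq u⟩
  have hx : ((ratToGLℂ L Jstar τ δ : GL (Fin 2) ℂ) : Matrix (Fin 2) (Fin 2) ℂ) *ᵥ v ∈ negCone (Jstar.map τ) := by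
    have h := smul_ratToGLℂ_mulVec_mem_negCone (L := L) (Jstar := Jstar) (τ := τ) δ one_ne_zero hv
    rwa [one_smul] at h
  -- `pts P = [v, uK] = [δ^τ v, g_q K]`
  have hPt : S.pts K P = ShimuraSetGS.mk L Jstar τ K.1.1
      (((ratToGLℂ L Jstar τ δ : GL (Fin 2) ℂ) : Matrix (Fin 2) (Fin 2) ℂ) *ᵥ v) hx (gq q) := by
    rw [← hP]
    exact ShimuraSetGS.mk_eq_mk_mulVec_rep v hv u (gq q) δ hδ hx
  -- so `P`, moved to `(M_K)_τ`, is the image of a point of the piece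
  have hQ : AlgPoints.baseChangeEquiv τ (S.M.obj K) P =
      AlgPoints.map (ι q) ((B q).unif (((ratToGLℂ L Jstar τ δ : GL (Fin 2) ℂ) : Matrix (Fin 2) (Fin 2) ℂ) *ᵥ v)) := by
    rw [(hB q).2.2 _ hx, ← hPt, Homeomorph.symm_apply_apply]
  have hfac : ι q ≫ Cofan.IsColimit.desc hcol ψq = ψq q := Cofan.IsColimit.fac hcol ψq q
  rw [hQ, ← AlgPoints.map_comp_apply, hfac, hψq, ← hQ, hΦpt]
  exact AlgPoints.baseChangeEquiv_apply_left_comp_fst (algebraMap ℚ ℂ) M (f (S.pts K P))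

end Slice

end Literature.AlgebraicGeometry.ShimuraVarieties.UnitaryCanonicalModel

end
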